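import Summits.QuantumFields.YangMills.Theorems.FluctuationComparisonRegPrIntLOrganTangentFibreMeanSquareKnit
import Mathlib.Algebra.QuadraticDiscriminant
import HarnessLib

/-!
# Crux `FluctuationComparisonRegPrIntL` (stmt-QuantumFields-20520, rung R3), PATH-B organ, v18 (H-currency): BRICK 3 —
# THE COVARIANCE (VARIANCE-ROAD) READING OF THE FIBRE-MEAN SQUARE KNIT (Cauchy–Schwarz in `L²(ŵ₀₀·P)`; abstract, DEFINITION-FREE)

Cell `ym3-torus` (YM ladder rung R3 = continuum `SU(2)` Yang–Mills on the three-torus — a RUNG: NOT d = 4, NOT infinite volume, NOT a mass gap, NOT Clay).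
LEAD-20520 width seat `ym-ust-20520-w3` (gen 25), BRICK 3 of the O1ᵘ-H v2 reduction, on top of BRICK 2b `…OrganTangentFibreMeanSquareKnit` (`fibreMean_secondDiff_eq`);
`--kind proof --supports stmt-QuantumFields-20520 --as helper`, count-neutral, no registry ∕ binder ∕ `Lines/` edit, default heartbeats, `autoImplicit false`.

WHY.  BRICK 2b's triangle-inequality reading bounds the two CROSS integrals and the CENTRED integral of the knit by «sup-oscillation × L¹-variation of the weights».  For
LINᵘ-H that is the WRONG road: the sup-oscillation of `h_{Ts}` over a small-field fibre is volume-sized (✓px19 `supOsc_core`: `≲ w·#PBond_{Ts}²∕θ_{Ts}`), so no m-uniform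
`Ctr` can come out of it (LEAD census v4.1 §6; typing note TN-OSC-LIN).  The right road is the VARIANCE road (as on the Jensen side, px5's JVARᵘ-H): the three integrals are
COVARIANCES, and Cauchy–Schwarz in `L²(ŵ₀₀·P)` splits each into «`L²(ŵ₀₀)`-deviation of (a first difference of) `h∘T` from a constant» × «`L²(ŵ₀₀)`-size of the
RELATIVE weight variation» — the first factor is what Brascamp–Lieb ∕ the cluster expansion of the small-field fluctuation measure controls with a `1∕β` ([Balaban1987RG1]
Thm 1 ∕ Thm 3, lit `B12`), the second is a χ²-type RN letter (weak background dependence of the fluctuation measure, [Balaban1987RG1] (0.22)∕(0.30); [Balaban1985Variational]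
Prop 9 for the transport).  NOTHING of that is here: this file is the Cauchy–Schwarz bookkeeping only.

WHAT.  §1 `abs_integral_mul_le_sqrt_mul_sqrt` — `|∫ f·g| ≤ √(∫ f²)·√(∫ g²)` (discriminant proof; `f², g², f·g` integrable).  §2 ★`abs_integral_centred_mul_sub_le` — for a
bounded `G`, a constant `c`, a reference weight `q ≥ 0` and a comparison weight `p = r·q` (relative density `r`): `|∫ (G − c)·(p − q)| ≤ √(∫ (G − c)²·q) · √(∫ (r − 1)²·q)`.
§3 ★★`abs_fibreMean_secondDiff_le_cov` — BRICK 2b's identity read through §2 with all weights relative to `ŵ₀₀` (`ŵ_ab = r_ab·ŵ₀₀`):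
`|ΔΔ m| ≤ A + √(∫(F₁₀ − F₀₀ − c₁)²ŵ₀₀)·√(∫(r₁₁ − r₁₀)²ŵ₀₀) + √(∫(F₀₁ − F₀₀ − c₂)²ŵ₀₀)·√(∫(r₁₁ − r₀₁)²ŵ₀₀) + √(∫(F₀₀ − c₀)²ŵ₀₀)·√(∫(r₁₁ − r₁₀ − r₀₁ + 1)²ŵ₀₀)`,
`A` = the sup of the pulled-back second difference (BRICK 2a).  With `cᵢ` the `ŵ₀₀`-means the first factors are VARIANCES of `h∘T` and of its first differences under the
reference fibre law; the second factors are `L²` relative-density variations (first and second order).  §3′ (TN-COV-3, ideator g27 №15: the GLOBAL `L²`-deviation of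
`F₀₀` is volume-sized under any massive fibre law, so channel 3 must be read PER LOCAL PIECE): `abs_integral_sum_centred_mul_le` and ★★`abs_fibreMean_secondDiff_le_cov_split`
— for `F₀₀ = Σ_{p∈s} c p·f p` the centred channel becomes `Σ_{p∈s} |c p|·|∫ (f p − fb p)·(ŵ₁₁ − ŵ₁₀ − ŵ₀₁ + ŵ₀₀)|`, each summand the SLOT for a per-piece
truncated-correlation DECAY letter (ideator's FIBRE-LAW-H (κ); [Balaban1987RG1] Thm 3 ∕ (0.30)).

HONEST FRAMING: Cauchy–Schwarz bookkeeping over HYPOTHESIS data; nothing of Bałaban's analysis is asserted or proved; transports, weights and letters for the runs are NOT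
constructed; LINᵘ-H ∕ JVARᵘ-H ∕ O1ᵘ-H v2 ∕ S1aᴴ ∕ 26243 ∕ S2α′ ∕ S2β OPEN; crux 20520 `FluctuationComparisonRegPrIntL` ∕ `YM3TorusSU2` NOT proved; no summit ∕ sub-problem statement
is proved; rung R3 = SU(2) YM₃ on T³ at fixed lattice data — NOT d = 4, NOT infinite volume, NOT a mass gap, NOT Clay; the Yang–Mills mass gap is NOT proved.  [folklore]
-/

set_option autoImplicit false

noncomputable section

namespace Summit.QuantumFields.YangMills.Theorems.OrganTangentFibreMeanCovarianceReading

open MeasureTheory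
open Summit.QuantumFields.YangMills.Theorems.OrganTangentFibreMeanSquareKnit (integrable_bdd_mul fibreMean_secondDiff_eq)

variable {Ω : Type*} [MeasurableSpace Ω]

/-! ## §1 Cauchy–Schwarz for real integrals (discriminant form) -/

/-- `|∫ f·g| ≤ √(∫ f²)·√(∫ g²)` for real functions with `f²`, `g²`, `f·g` integrable (any measure). [folklore] -/
theorem abs_integral_mul_le_sqrt_mul_sqrt (P : Measure Ω) {f g : Ω → ℝ}
    (hf2 : Integrable (fun ξ => f ξ ^ 2) P) (hg2 : Integrable (fun ξ => g ξ ^ 2) P) (hfg : Integrable (fun ξ => f ξ * g ξ) P) :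
    |∫ ξ, f ξ * g ξ ∂P| ≤ Real.sqrt (∫ ξ, f ξ ^ 2 ∂P) * Real.sqrt (∫ ξ, g ξ ^ 2 ∂P) := by
  set A := ∫ ξ, g ξ ^ 2 ∂P with hA
  set B := ∫ ξ, f ξ * g ξ ∂P with hB
  set C := ∫ ξ, f ξ ^ 2 ∂P with hC
  have hA0 : 0 ≤ A := integral_nonneg (fun ξ => sq_nonneg _)
  have hC0 : 0 ≤ C := integral_nonneg (fun ξ => sq_nonneg _)
  -- the quadratic `t ↦ ∫ (f − t g)² = C − 2B t + A t²` is nonnegative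
  have hquad : ∀ t : ℝ, 0 ≤ A * (t * t) + (-(2 * B)) * t + C := by
    intro t
    have hint : Integrable (fun ξ => (f ξ - t * g ξ) ^ 2) P := by
      have h : (fun ξ => (f ξ - t * g ξ) ^ 2) = fun ξ => f ξ ^ 2 - (2 * t) * (f ξ * g ξ) + (t * t) * g ξ ^ 2 := by
        funext ξ; ring
      rw [h]
      exact (hf2.sub (hfg.const_mul _)).add (hg2.const_mul _)
    have hnn : 0 ≤ ∫ ξ, (f ξ - t * g ξ) ^ 2 ∂P := integral_nonneg (fun ξ => sq_nonneg _)
    have hexp : ∫ ξ, (f ξ - t * g ξ) ^ 2 ∂P = C - (2 * t) * B + (t * t) * A := by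
      have h : (fun ξ => (f ξ - t * g ξ) ^ 2) = fun ξ => f ξ ^ 2 - (2 * t) * (f ξ * g ξ) + (t * t) * g ξ ^ 2 := by
        funext ξ; ring
      rw [h, integral_add ?_ (hg2.const_mul _), integral_sub hf2 (hfg.const_mul _), integral_const_mul, integral_const_mul]
      exact hf2.sub (hfg.const_mul _)
    rw [hexp] at hnn
    linarith
  have hdisc := discrim_le_zero hquad
  rw [discrim] at hdisc
  have hB2 : B ^ 2 ≤ C * A := by nlinarith [hdisc]
  calc |B| = Real.sqrt (B ^ 2) := (Real.sqrt_sq_eq_abs B).symm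
    _ ≤ Real.sqrt (C * A) := Real.sqrt_le_sqrt hB2
    _ = Real.sqrt C * Real.sqrt A := Real.sqrt_mul hC0 A

/-! ## §2 The centred product against a weight difference, relative-density form -/

/-- ★ **COVARIANCE READING OF ONE TERM**: for a bounded `G`, a constant `c`, a reference weight `q ≥ 0` and a comparison weight `p = r·q`,
`|∫ (G − c)·(p − q)| ≤ √(∫ (G − c)²·q) · √(∫ (r − 1)²·q)`. [folklore] -/
theorem abs_integral_centred_mul_sub_le (P : Measure Ω) (G p q r : Ω → ℝ) (M c : ℝ)
    (hGm : AEStronglyMeasurable G P) (hGb : ∀ ξ, |G ξ| ≤ M)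
    (hq : Integrable q P) (hq0 : ∀ ξ, 0 ≤ q ξ) (hp : Integrable p P) (hpr : ∀ ξ, p ξ = r ξ * q ξ)
    (hr2 : Integrable (fun ξ => (r ξ - 1) ^ 2 * q ξ) P) :
    |∫ ξ, (G ξ - c) * (p ξ - q ξ) ∂P| ≤ Real.sqrt (∫ ξ, (G ξ - c) ^ 2 * q ξ ∂P) * Real.sqrt (∫ ξ, (r ξ - 1) ^ 2 * q ξ ∂P) := by
  -- f := (G − c)·√q, g := (r − 1)·√q
  have hsq : ∀ ξ, Real.sqrt (q ξ) * Real.sqrt (q ξ) = q ξ := fun ξ => Real.mul_self_sqrt (hq0 ξ)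
  have hGc_b : ∀ ξ, |G ξ - c| ≤ M + |c| := fun ξ => by
    calc |G ξ - c| ≤ |G ξ| + |c| := abs_sub _ _
      _ ≤ M + |c| := by linarith [hGb ξ]
  have hGc_m : AEStronglyMeasurable (fun ξ => G ξ - c) P := hGm.sub aestronglyMeasurable_const
  have hf2 : Integrable (fun ξ => ((G ξ - c) * Real.sqrt (q ξ)) ^ 2) P := by
    have h : (fun ξ => ((G ξ - c) * Real.sqrt (q ξ)) ^ 2) = fun ξ => ((G ξ - c) * (G ξ - c)) * q ξ := by
      funext ξ; rw [mul_pow, sq, sq, hsq ξ]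
    rw [h]
    refine integrable_bdd_mul (M := (M + |c|) * (M + |c|)) (hGc_m.mul hGc_m) (fun ξ => ?_) hq
    rw [abs_mul]
    exact mul_le_mul (hGc_b ξ) (hGc_b ξ) (abs_nonneg _) (le_trans (abs_nonneg _) (hGc_b ξ))
  have hg2 : Integrable (fun ξ => ((r ξ - 1) * Real.sqrt (q ξ)) ^ 2) P := by
    have h : (fun ξ => ((r ξ - 1) * Real.sqrt (q ξ)) ^ 2) = fun ξ => (r ξ - 1) ^ 2 * q ξ := by
      funext ξ; rw [mul_pow, sq (Real.sqrt _), hsq ξ]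
    rw [h]; exact hr2
  have hfg_eq : (fun ξ => ((G ξ - c) * Real.sqrt (q ξ)) * ((r ξ - 1) * Real.sqrt (q ξ))) = fun ξ => (G ξ - c) * (p ξ - q ξ) := by
    funext ξ
    have : p ξ - q ξ = (r ξ - 1) * q ξ := by rw [hpr ξ]; ring
    rw [this]
    linear_combination (G ξ - c) * (r ξ - 1) * hsq ξ
  have hfg : Integrable (fun ξ => ((G ξ - c) * Real.sqrt (q ξ)) * ((r ξ - 1) * Real.sqrt (q ξ))) P := by
    rw [hfg_eq]
    exact integrable_bdd_mul (M := M + |c|) hGc_m hGc_b (hp.sub hq)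
  have hcs := abs_integral_mul_le_sqrt_mul_sqrt P hf2 hg2 hfg
  rw [hfg_eq] at hcs
  have e1 : (∫ ξ, ((G ξ - c) * Real.sqrt (q ξ)) ^ 2 ∂P) = ∫ ξ, (G ξ - c) ^ 2 * q ξ ∂P := by
    refine integral_congr_ae (Filter.Eventually.of_forall (fun ξ => ?_))
    simp only [mul_pow, sq (Real.sqrt _), hsq ξ]
  have e2 : (∫ ξ, ((r ξ - 1) * Real.sqrt (q ξ)) ^ 2 ∂P) = ∫ ξ, (r ξ - 1) ^ 2 * q ξ ∂P := by
    refine integral_congr_ae (Filter.Eventually.of_forall (fun ξ => ?_))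
    simp only [mul_pow, sq (Real.sqrt _), hsq ξ]
  rw [e1, e2] at hcs
  exact hcs

/-! ## §3 The knit through Cauchy–Schwarz: the variance road -/

/-- ★★ **THE VARIANCE-ROAD READING OF THE FIBRE-MEAN SQUARE KNIT** (all weights relative to `ŵ₀₀`: `ŵ_ab = r_ab·ŵ₀₀`, `∫ ŵ_ab = 1`, `ŵ₀₀, ŵ₁₁ ≥ 0`): pulled-back sup term
plus three Cauchy–Schwarz products «`L²(ŵ₀₀)`-deviation of (a first difference of) `F` from a constant» × «`L²(ŵ₀₀)` relative-weight variation». [folklore] -/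
theorem abs_fibreMean_secondDiff_le_cov (P : Measure Ω)
    (F₀₀ F₁₀ F₀₁ F₁₁ w₀₀ w₁₀ w₀₁ w₁₁ r₁₀ r₀₁ r₁₁ : Ω → ℝ) (M c₁ c₂ c₀ A : ℝ)
    (hF₀₀ : AEStronglyMeasurable F₀₀ P) (hF₁₀ : AEStronglyMeasurable F₁₀ P)
    (hF₀₁ : AEStronglyMeasurable F₀₁ P) (hF₁₁ : AEStronglyMeasurable F₁₁ P)
    (hb₀₀ : ∀ ξ, |F₀₀ ξ| ≤ M) (hb₁₀ : ∀ ξ, |F₁₀ ξ| ≤ M) (hb₀₁ : ∀ ξ, |F₀₁ ξ| ≤ M) (hb₁₁ : ∀ ξ, |F₁₁ ξ| ≤ M)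
    (hw₀₀ : Integrable w₀₀ P) (hw₁₀ : Integrable w₁₀ P) (hw₀₁ : Integrable w₀₁ P) (hw₁₁ : Integrable w₁₁ P)
    (hn₀₀ : ∫ ξ, w₀₀ ξ ∂P = 1) (hn₁₀ : ∫ ξ, w₁₀ ξ ∂P = 1) (hn₀₁ : ∫ ξ, w₀₁ ξ ∂P = 1) (hn₁₁ : ∫ ξ, w₁₁ ξ ∂P = 1)
    (hpos₀₀ : ∀ ξ, 0 ≤ w₀₀ ξ) (hpos₁₁ : ∀ ξ, 0 ≤ w₁₁ ξ)
    (hr₁₀ : ∀ ξ, w₁₀ ξ = r₁₀ ξ * w₀₀ ξ) (hr₀₁ : ∀ ξ, w₀₁ ξ = r₀₁ ξ * w₀₀ ξ) (hr₁₁ : ∀ ξ, w₁₁ ξ = r₁₁ ξ * w₀₀ ξ)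
    (hv₁ : Integrable (fun ξ => (r₁₁ ξ - r₁₀ ξ) ^ 2 * w₀₀ ξ) P) (hv₂ : Integrable (fun ξ => (r₁₁ ξ - r₀₁ ξ) ^ 2 * w₀₀ ξ) P)
    (hv₀ : Integrable (fun ξ => (r₁₁ ξ - r₁₀ ξ - r₀₁ ξ + 1) ^ 2 * w₀₀ ξ) P)
    (hA : ∀ ξ, |F₁₁ ξ - F₁₀ ξ - F₀₁ ξ + F₀₀ ξ| ≤ A) :
    |(∫ ξ, F₁₁ ξ * w₁₁ ξ ∂P) - (∫ ξ, F₁₀ ξ * w₁₀ ξ ∂P) - (∫ ξ, F₀₁ ξ * w₀₁ ξ ∂P) + (∫ ξ, F₀₀ ξ * w₀₀ ξ ∂P)|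
      ≤ A + Real.sqrt (∫ ξ, (F₁₀ ξ - F₀₀ ξ - c₁) ^ 2 * w₀₀ ξ ∂P) * Real.sqrt (∫ ξ, (r₁₁ ξ - r₁₀ ξ) ^ 2 * w₀₀ ξ ∂P)
        + Real.sqrt (∫ ξ, (F₀₁ ξ - F₀₀ ξ - c₂) ^ 2 * w₀₀ ξ ∂P) * Real.sqrt (∫ ξ, (r₁₁ ξ - r₀₁ ξ) ^ 2 * w₀₀ ξ ∂P)
        + Real.sqrt (∫ ξ, (F₀₀ ξ - c₀) ^ 2 * w₀₀ ξ ∂P) * Real.sqrt (∫ ξ, (r₁₁ ξ - r₁₀ ξ - r₀₁ ξ + 1) ^ 2 * w₀₀ ξ ∂P) := by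
  rw [fibreMean_secondDiff_eq P F₀₀ F₁₀ F₀₁ F₁₁ w₀₀ w₁₀ w₀₁ w₁₁ M c₁ c₂ c₀ hF₀₀ hF₁₀ hF₀₁ hF₁₁ hb₀₀ hb₁₀ hb₀₁ hb₁₁
    hw₀₀ hw₁₀ hw₀₁ hw₁₁ hn₀₀ hn₁₀ hn₀₁ hn₁₁]
  -- term 1 (pull-back): |∫ ΔΔF · w₁₁| ≤ A
  have t1 : |∫ ξ, (F₁₁ ξ - F₁₀ ξ - F₀₁ ξ + F₀₀ ξ) * w₁₁ ξ ∂P| ≤ A := by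
    have hle : ∀ ξ, |(F₁₁ ξ - F₁₀ ξ - F₀₁ ξ + F₀₀ ξ) * w₁₁ ξ| ≤ A * w₁₁ ξ := fun ξ => by
      rw [abs_mul, abs_of_nonneg (hpos₁₁ ξ)]
      exact mul_le_mul_of_nonneg_right (hA ξ) (hpos₁₁ ξ)
    calc |∫ ξ, (F₁₁ ξ - F₁₀ ξ - F₀₁ ξ + F₀₀ ξ) * w₁₁ ξ ∂P|
        ≤ ∫ ξ, |(F₁₁ ξ - F₁₀ ξ - F₀₁ ξ + F₀₀ ξ) * w₁₁ ξ| ∂P := by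
          simpa only [Real.norm_eq_abs] using norm_integral_le_integral_norm (fun ξ => (F₁₁ ξ - F₁₀ ξ - F₀₁ ξ + F₀₀ ξ) * w₁₁ ξ)
      _ ≤ ∫ ξ, A * w₁₁ ξ ∂P := by
          refine integral_mono_of_nonneg (Filter.Eventually.of_forall (fun ξ => abs_nonneg _)) (hw₁₁.const_mul A)
            (Filter.Eventually.of_forall hle)
      _ = A := by rw [integral_const_mul, hn₁₁, mul_one]
  -- the three covariance terms via §2 (reference weight `w₀₀`)
  have hG1m : AEStronglyMeasurable (fun ξ => F₁₀ ξ - F₀₀ ξ) P := hF₁₀.sub hF₀₀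
  have hG1b : ∀ ξ, |F₁₀ ξ - F₀₀ ξ| ≤ M + M := fun ξ => (abs_sub _ _).trans (add_le_add (hb₁₀ ξ) (hb₀₀ ξ))
  have hG2m : AEStronglyMeasurable (fun ξ => F₀₁ ξ - F₀₀ ξ) P := hF₀₁.sub hF₀₀
  have hG2b : ∀ ξ, |F₀₁ ξ - F₀₀ ξ| ≤ M + M := fun ξ => (abs_sub _ _).trans (add_le_add (hb₀₁ ξ) (hb₀₀ ξ))
  -- (i) p := w₁₁ − w₁₀ + w₀₀ = (r₁₁ − r₁₀ + 1)·w₀₀, so that p − q = w₁₁ − w₁₀ with q := w₀₀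
  have t2 := abs_integral_centred_mul_sub_le P (fun ξ => F₁₀ ξ - F₀₀ ξ) (fun ξ => w₁₁ ξ - w₁₀ ξ + w₀₀ ξ) w₀₀
    (fun ξ => r₁₁ ξ - r₁₀ ξ + 1) (M + M) c₁ hG1m hG1b hw₀₀ hpos₀₀ ((hw₁₁.sub hw₁₀).add hw₀₀)
    (fun ξ => by simp only [hr₁₁ ξ, hr₁₀ ξ]; ring)
    (by have h : (fun ξ => (r₁₁ ξ - r₁₀ ξ + 1 - 1) ^ 2 * w₀₀ ξ) = fun ξ => (r₁₁ ξ - r₁₀ ξ) ^ 2 * w₀₀ ξ := by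
          funext ξ; ring
        rw [h]; exact hv₁)
  have t3 := abs_integral_centred_mul_sub_le P (fun ξ => F₀₁ ξ - F₀₀ ξ) (fun ξ => w₁₁ ξ - w₀₁ ξ + w₀₀ ξ) w₀₀
    (fun ξ => r₁₁ ξ - r₀₁ ξ + 1) (M + M) c₂ hG2m hG2b hw₀₀ hpos₀₀ ((hw₁₁.sub hw₀₁).add hw₀₀)
    (fun ξ => by simp only [hr₁₁ ξ, hr₀₁ ξ]; ring)
    (by have h : (fun ξ => (r₁₁ ξ - r₀₁ ξ + 1 - 1) ^ 2 * w₀₀ ξ) = fun ξ => (r₁₁ ξ - r₀₁ ξ) ^ 2 * w₀₀ ξ := by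
          funext ξ; ring
        rw [h]; exact hv₂)
  have t4 := abs_integral_centred_mul_sub_le P F₀₀ (fun ξ => w₁₁ ξ - w₁₀ ξ - w₀₁ ξ + w₀₀ ξ + w₀₀ ξ) w₀₀
    (fun ξ => r₁₁ ξ - r₁₀ ξ - r₀₁ ξ + 1 + 1) M c₀ hF₀₀ hb₀₀ hw₀₀ hpos₀₀ ((((hw₁₁.sub hw₁₀).sub hw₀₁).add hw₀₀).add hw₀₀)
    (fun ξ => by simp only [hr₁₁ ξ, hr₁₀ ξ, hr₀₁ ξ]; ring)
    (by have h : (fun ξ => (r₁₁ ξ - r₁₀ ξ - r₀₁ ξ + 1 + 1 - 1) ^ 2 * w₀₀ ξ) = fun ξ => (r₁₁ ξ - r₁₀ ξ - r₀₁ ξ + 1) ^ 2 * w₀₀ ξ := by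
          funext ξ; ring
        rw [h]; exact hv₀)
  -- rewrite the integrands of t2–t4 to the knit's shape
  have s2 : (∫ ξ, (F₁₀ ξ - F₀₀ ξ - c₁) * (w₁₁ ξ - w₁₀ ξ + w₀₀ ξ - w₀₀ ξ) ∂P) = ∫ ξ, (F₁₀ ξ - F₀₀ ξ - c₁) * (w₁₁ ξ - w₁₀ ξ) ∂P := by
    refine integral_congr_ae (Filter.Eventually.of_forall (fun ξ => ?_)); ring
  have s3 : (∫ ξ, (F₀₁ ξ - F₀₀ ξ - c₂) * (w₁₁ ξ - w₀₁ ξ + w₀₀ ξ - w₀₀ ξ) ∂P) = ∫ ξ, (F₀₁ ξ - F₀₀ ξ - c₂) * (w₁₁ ξ - w₀₁ ξ) ∂P := by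
    refine integral_congr_ae (Filter.Eventually.of_forall (fun ξ => ?_)); ring
  have s4 : (∫ ξ, (F₀₀ ξ - c₀) * (w₁₁ ξ - w₁₀ ξ - w₀₁ ξ + w₀₀ ξ + w₀₀ ξ - w₀₀ ξ) ∂P)
      = ∫ ξ, (F₀₀ ξ - c₀) * (w₁₁ ξ - w₁₀ ξ - w₀₁ ξ + w₀₀ ξ) ∂P := by
    refine integral_congr_ae (Filter.Eventually.of_forall (fun ξ => ?_)); ring
  have s4' : (∫ ξ, (r₁₁ ξ - r₁₀ ξ - r₀₁ ξ + 1 + 1 - 1) ^ 2 * w₀₀ ξ ∂P) = ∫ ξ, (r₁₁ ξ - r₁₀ ξ - r₀₁ ξ + 1) ^ 2 * w₀₀ ξ ∂P := by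
    refine integral_congr_ae (Filter.Eventually.of_forall (fun ξ => ?_)); ring
  have s2' : (∫ ξ, (r₁₁ ξ - r₁₀ ξ + 1 - 1) ^ 2 * w₀₀ ξ ∂P) = ∫ ξ, (r₁₁ ξ - r₁₀ ξ) ^ 2 * w₀₀ ξ ∂P := by
    refine integral_congr_ae (Filter.Eventually.of_forall (fun ξ => ?_)); ring
  have s3' : (∫ ξ, (r₁₁ ξ - r₀₁ ξ + 1 - 1) ^ 2 * w₀₀ ξ ∂P) = ∫ ξ, (r₁₁ ξ - r₀₁ ξ) ^ 2 * w₀₀ ξ ∂P := by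
    refine integral_congr_ae (Filter.Eventually.of_forall (fun ξ => ?_)); ring
  simp only [s2, s2'] at t2
  simp only [s3, s3'] at t3
  simp only [s4, s4'] at t4
  calc |(∫ ξ, (F₁₁ ξ - F₁₀ ξ - F₀₁ ξ + F₀₀ ξ) * w₁₁ ξ ∂P)
        + (∫ ξ, (F₁₀ ξ - F₀₀ ξ - c₁) * (w₁₁ ξ - w₁₀ ξ) ∂P)
        + (∫ ξ, (F₀₁ ξ - F₀₀ ξ - c₂) * (w₁₁ ξ - w₀₁ ξ) ∂P)
        + (∫ ξ, (F₀₀ ξ - c₀) * (w₁₁ ξ - w₁₀ ξ - w₀₁ ξ + w₀₀ ξ) ∂P)|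
      ≤ |∫ ξ, (F₁₁ ξ - F₁₀ ξ - F₀₁ ξ + F₀₀ ξ) * w₁₁ ξ ∂P|
        + |∫ ξ, (F₁₀ ξ - F₀₀ ξ - c₁) * (w₁₁ ξ - w₁₀ ξ) ∂P|
        + |∫ ξ, (F₀₁ ξ - F₀₀ ξ - c₂) * (w₁₁ ξ - w₀₁ ξ) ∂P|
        + |∫ ξ, (F₀₀ ξ - c₀) * (w₁₁ ξ - w₁₀ ξ - w₀₁ ξ + w₀₀ ξ) ∂P| := by
          refine le_trans (abs_add_le _ _) (add_le_add (le_trans (abs_add_le _ _) (add_le_add (abs_add_le _ _) le_rfl)) le_rfl)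
    _ ≤ _ := add_le_add (add_le_add (add_le_add t1 t2) t3) t4

/-! ## §3′ TN-COV-3 (ideator g27 №15): the CENTRED channel split per local piece — the slot for a truncated-correlation DECAY letter -/

/-- The centred pairing of a FINITE SUM of bounded local pieces `F = Σ_{p∈s} c p·f p` against an integrable `u`, centred at `c₀ := Σ c p·fb p`, splits as
`|∫ (F − c₀)·u| ≤ Σ_{p∈s} |c p|·|∫ (f p − fb p)·u|` — each summand is the SLOT where a per-piece truncated-correlation decay letter enters. [folklore] -/
theorem abs_integral_sum_centred_mul_le {ι : Type*} (P : Measure Ω) (s : Finset ι) (c fb : ι → ℝ) (f : ι → Ω → ℝ) (F u : Ω → ℝ) (Mf : ℝ)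
    (hfm : ∀ p, AEStronglyMeasurable (f p) P) (hfb : ∀ p ξ, |f p ξ| ≤ Mf) (hu : Integrable u P)
    (hF : ∀ ξ, F ξ = ∑ p ∈ s, c p * f p ξ) :
    |∫ ξ, (F ξ - ∑ p ∈ s, c p * fb p) * u ξ ∂P| ≤ ∑ p ∈ s, |c p| * |∫ ξ, (f p ξ - fb p) * u ξ ∂P| := by
  have hint : ∀ p, Integrable (fun ξ => (f p ξ - fb p) * u ξ) P := fun p =>
    integrable_bdd_mul (M := Mf + |fb p|) ((hfm p).sub aestronglyMeasurable_const)
      (fun ξ => (abs_sub _ _).trans (by linarith [hfb p ξ, le_refl |fb p|])) hu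
  have hpt : (fun ξ => (F ξ - ∑ p ∈ s, c p * fb p) * u ξ) = fun ξ => ∑ p ∈ s, c p * ((f p ξ - fb p) * u ξ) := by
    funext ξ
    rw [hF ξ, ← Finset.sum_sub_distrib, Finset.sum_mul]
    refine Finset.sum_congr rfl (fun p _ => by ring)
  rw [hpt, integral_finsetSum s (fun p _ => (hint p).const_mul (c p))]
  refine (Finset.abs_sum_le_sum_abs _ _).trans (Finset.sum_le_sum (fun p _ => ?_))
  rw [integral_const_mul, abs_mul]

/-- ★★ **THE VARIANCE-ROAD READING WITH THE CENTRED CHANNEL SPLIT PER LOCAL PIECE** (TN-COV-3, ideator g27 №15: the global `L²`-deviation of `F₀₀ = h∘T` is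
volume-sized; the m-uniform reading pairs each local piece with the weights' second variation): channels 1–2 by Cauchy–Schwarz as in ★★`abs_fibreMean_secondDiff_le_cov`,
channel 3 as `Σ_{p∈s} |c p|·|∫ (f p − fb p)·(ŵ₁₁ − ŵ₁₀ − ŵ₀₁ + ŵ₀₀)|` for `F₀₀ = Σ_{p∈s} c p·f p`. [folklore] -/
theorem abs_fibreMean_secondDiff_le_cov_split {ι : Type*} (P : Measure Ω)
    (F₀₀ F₁₀ F₀₁ F₁₁ w₀₀ w₁₀ w₀₁ w₁₁ r₁₀ r₀₁ r₁₁ : Ω → ℝ) (M c₁ c₂ A : ℝ)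
    (s : Finset ι) (c fb : ι → ℝ) (f : ι → Ω → ℝ) (Mf : ℝ)
    (hF₀₀ : AEStronglyMeasurable F₀₀ P) (hF₁₀ : AEStronglyMeasurable F₁₀ P)
    (hF₀₁ : AEStronglyMeasurable F₀₁ P) (hF₁₁ : AEStronglyMeasurable F₁₁ P)
    (hb₀₀ : ∀ ξ, |F₀₀ ξ| ≤ M) (hb₁₀ : ∀ ξ, |F₁₀ ξ| ≤ M) (hb₀₁ : ∀ ξ, |F₀₁ ξ| ≤ M) (hb₁₁ : ∀ ξ, |F₁₁ ξ| ≤ M)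
    (hw₀₀ : Integrable w₀₀ P) (hw₁₀ : Integrable w₁₀ P) (hw₀₁ : Integrable w₀₁ P) (hw₁₁ : Integrable w₁₁ P)
    (hn₀₀ : ∫ ξ, w₀₀ ξ ∂P = 1) (hn₁₀ : ∫ ξ, w₁₀ ξ ∂P = 1) (hn₀₁ : ∫ ξ, w₀₁ ξ ∂P = 1) (hn₁₁ : ∫ ξ, w₁₁ ξ ∂P = 1)
    (hpos₀₀ : ∀ ξ, 0 ≤ w₀₀ ξ) (hpos₁₁ : ∀ ξ, 0 ≤ w₁₁ ξ)
    (hr₁₀ : ∀ ξ, w₁₀ ξ = r₁₀ ξ * w₀₀ ξ) (hr₀₁ : ∀ ξ, w₀₁ ξ = r₀₁ ξ * w₀₀ ξ) (hr₁₁ : ∀ ξ, w₁₁ ξ = r₁₁ ξ * w₀₀ ξ)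
    (hv₁ : Integrable (fun ξ => (r₁₁ ξ - r₁₀ ξ) ^ 2 * w₀₀ ξ) P) (hv₂ : Integrable (fun ξ => (r₁₁ ξ - r₀₁ ξ) ^ 2 * w₀₀ ξ) P)
    (hA : ∀ ξ, |F₁₁ ξ - F₁₀ ξ - F₀₁ ξ + F₀₀ ξ| ≤ A)
    (hfm : ∀ p, AEStronglyMeasurable (f p) P) (hfb : ∀ p ξ, |f p ξ| ≤ Mf) (hF : ∀ ξ, F₀₀ ξ = ∑ p ∈ s, c p * f p ξ) :
    |(∫ ξ, F₁₁ ξ * w₁₁ ξ ∂P) - (∫ ξ, F₁₀ ξ * w₁₀ ξ ∂P) - (∫ ξ, F₀₁ ξ * w₀₁ ξ ∂P) + (∫ ξ, F₀₀ ξ * w₀₀ ξ ∂P)|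
      ≤ A + Real.sqrt (∫ ξ, (F₁₀ ξ - F₀₀ ξ - c₁) ^ 2 * w₀₀ ξ ∂P) * Real.sqrt (∫ ξ, (r₁₁ ξ - r₁₀ ξ) ^ 2 * w₀₀ ξ ∂P)
        + Real.sqrt (∫ ξ, (F₀₁ ξ - F₀₀ ξ - c₂) ^ 2 * w₀₀ ξ ∂P) * Real.sqrt (∫ ξ, (r₁₁ ξ - r₀₁ ξ) ^ 2 * w₀₀ ξ ∂P)
        + ∑ p ∈ s, |c p| * |∫ ξ, (f p ξ - fb p) * (w₁₁ ξ - w₁₀ ξ - w₀₁ ξ + w₀₀ ξ) ∂P| := by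
  rw [fibreMean_secondDiff_eq P F₀₀ F₁₀ F₀₁ F₁₁ w₀₀ w₁₀ w₀₁ w₁₁ M c₁ c₂ (∑ p ∈ s, c p * fb p) hF₀₀ hF₁₀ hF₀₁ hF₁₁ hb₀₀ hb₁₀ hb₀₁ hb₁₁
    hw₀₀ hw₁₀ hw₀₁ hw₁₁ hn₀₀ hn₁₀ hn₀₁ hn₁₁]
  have t1 : |∫ ξ, (F₁₁ ξ - F₁₀ ξ - F₀₁ ξ + F₀₀ ξ) * w₁₁ ξ ∂P| ≤ A := by
    have hle : ∀ ξ, |(F₁₁ ξ - F₁₀ ξ - F₀₁ ξ + F₀₀ ξ) * w₁₁ ξ| ≤ A * w₁₁ ξ := fun ξ => by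
      rw [abs_mul, abs_of_nonneg (hpos₁₁ ξ)]
      exact mul_le_mul_of_nonneg_right (hA ξ) (hpos₁₁ ξ)
    calc |∫ ξ, (F₁₁ ξ - F₁₀ ξ - F₀₁ ξ + F₀₀ ξ) * w₁₁ ξ ∂P|
        ≤ ∫ ξ, |(F₁₁ ξ - F₁₀ ξ - F₀₁ ξ + F₀₀ ξ) * w₁₁ ξ| ∂P := by
          simpa only [Real.norm_eq_abs] using norm_integral_le_integral_norm (fun ξ => (F₁₁ ξ - F₁₀ ξ - F₀₁ ξ + F₀₀ ξ) * w₁₁ ξ)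
      _ ≤ ∫ ξ, A * w₁₁ ξ ∂P := by
          refine integral_mono_of_nonneg (Filter.Eventually.of_forall (fun ξ => abs_nonneg _)) (hw₁₁.const_mul A)
            (Filter.Eventually.of_forall hle)
      _ = A := by rw [integral_const_mul, hn₁₁, mul_one]
  have hG1m : AEStronglyMeasurable (fun ξ => F₁₀ ξ - F₀₀ ξ) P := hF₁₀.sub hF₀₀
  have hG1b : ∀ ξ, |F₁₀ ξ - F₀₀ ξ| ≤ M + M := fun ξ => (abs_sub _ _).trans (add_le_add (hb₁₀ ξ) (hb₀₀ ξ))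
  have hG2m : AEStronglyMeasurable (fun ξ => F₀₁ ξ - F₀₀ ξ) P := hF₀₁.sub hF₀₀
  have hG2b : ∀ ξ, |F₀₁ ξ - F₀₀ ξ| ≤ M + M := fun ξ => (abs_sub _ _).trans (add_le_add (hb₀₁ ξ) (hb₀₀ ξ))
  have t2 := abs_integral_centred_mul_sub_le P (fun ξ => F₁₀ ξ - F₀₀ ξ) (fun ξ => w₁₁ ξ - w₁₀ ξ + w₀₀ ξ) w₀₀
    (fun ξ => r₁₁ ξ - r₁₀ ξ + 1) (M + M) c₁ hG1m hG1b hw₀₀ hpos₀₀ ((hw₁₁.sub hw₁₀).add hw₀₀)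
    (fun ξ => by simp only [hr₁₁ ξ, hr₁₀ ξ]; ring)
    (by have h : (fun ξ => (r₁₁ ξ - r₁₀ ξ + 1 - 1) ^ 2 * w₀₀ ξ) = fun ξ => (r₁₁ ξ - r₁₀ ξ) ^ 2 * w₀₀ ξ := by
          funext ξ; ring
        rw [h]; exact hv₁)
  have t3 := abs_integral_centred_mul_sub_le P (fun ξ => F₀₁ ξ - F₀₀ ξ) (fun ξ => w₁₁ ξ - w₀₁ ξ + w₀₀ ξ) w₀₀
    (fun ξ => r₁₁ ξ - r₀₁ ξ + 1) (M + M) c₂ hG2m hG2b hw₀₀ hpos₀₀ ((hw₁₁.sub hw₀₁).add hw₀₀)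
    (fun ξ => by simp only [hr₁₁ ξ, hr₀₁ ξ]; ring)
    (by have h : (fun ξ => (r₁₁ ξ - r₀₁ ξ + 1 - 1) ^ 2 * w₀₀ ξ) = fun ξ => (r₁₁ ξ - r₀₁ ξ) ^ 2 * w₀₀ ξ := by
          funext ξ; ring
        rw [h]; exact hv₂)
  have t4 := abs_integral_sum_centred_mul_le P s c fb f F₀₀ (fun ξ => w₁₁ ξ - w₁₀ ξ - w₀₁ ξ + w₀₀ ξ) Mf hfm hfb
    ((((hw₁₁.sub hw₁₀).sub hw₀₁).add hw₀₀)) hF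
  have s2 : (∫ ξ, (F₁₀ ξ - F₀₀ ξ - c₁) * (w₁₁ ξ - w₁₀ ξ + w₀₀ ξ - w₀₀ ξ) ∂P) = ∫ ξ, (F₁₀ ξ - F₀₀ ξ - c₁) * (w₁₁ ξ - w₁₀ ξ) ∂P := by
    refine integral_congr_ae (Filter.Eventually.of_forall (fun ξ => ?_)); ring
  have s3 : (∫ ξ, (F₀₁ ξ - F₀₀ ξ - c₂) * (w₁₁ ξ - w₀₁ ξ + w₀₀ ξ - w₀₀ ξ) ∂P) = ∫ ξ, (F₀₁ ξ - F₀₀ ξ - c₂) * (w₁₁ ξ - w₀₁ ξ) ∂P := by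
    refine integral_congr_ae (Filter.Eventually.of_forall (fun ξ => ?_)); ring
  have s2' : (∫ ξ, (r₁₁ ξ - r₁₀ ξ + 1 - 1) ^ 2 * w₀₀ ξ ∂P) = ∫ ξ, (r₁₁ ξ - r₁₀ ξ) ^ 2 * w₀₀ ξ ∂P := by
    refine integral_congr_ae (Filter.Eventually.of_forall (fun ξ => ?_)); ring
  have s3' : (∫ ξ, (r₁₁ ξ - r₀₁ ξ + 1 - 1) ^ 2 * w₀₀ ξ ∂P) = ∫ ξ, (r₁₁ ξ - r₀₁ ξ) ^ 2 * w₀₀ ξ ∂P := by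
    refine integral_congr_ae (Filter.Eventually.of_forall (fun ξ => ?_)); ring
  simp only [s2, s2'] at t2
  simp only [s3, s3'] at t3
  calc |(∫ ξ, (F₁₁ ξ - F₁₀ ξ - F₀₁ ξ + F₀₀ ξ) * w₁₁ ξ ∂P)
        + (∫ ξ, (F₁₀ ξ - F₀₀ ξ - c₁) * (w₁₁ ξ - w₁₀ ξ) ∂P)
        + (∫ ξ, (F₀₁ ξ - F₀₀ ξ - c₂) * (w₁₁ ξ - w₀₁ ξ) ∂P)
        + (∫ ξ, (F₀₀ ξ - ∑ p ∈ s, c p * fb p) * (w₁₁ ξ - w₁₀ ξ - w₀₁ ξ + w₀₀ ξ) ∂P)|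
      ≤ |∫ ξ, (F₁₁ ξ - F₁₀ ξ - F₀₁ ξ + F₀₀ ξ) * w₁₁ ξ ∂P|
        + |∫ ξ, (F₁₀ ξ - F₀₀ ξ - c₁) * (w₁₁ ξ - w₁₀ ξ) ∂P|
        + |∫ ξ, (F₀₁ ξ - F₀₀ ξ - c₂) * (w₁₁ ξ - w₀₁ ξ) ∂P|
        + |∫ ξ, (F₀₀ ξ - ∑ p ∈ s, c p * fb p) * (w₁₁ ξ - w₁₀ ξ - w₀₁ ξ + w₀₀ ξ) ∂P| := by
          refine le_trans (abs_add_le _ _) (add_le_add (le_trans (abs_add_le _ _) (add_le_add (abs_add_le _ _) le_rfl)) le_rfl)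
    _ ≤ _ := add_le_add (add_le_add (add_le_add t1 t2) t3) t4

end Summit.QuantumFields.YangMills.Theorems.OrganTangentFibreMeanCovarianceReading

end
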